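import Summits.QuantumFields.YangMills.Theorems.BalabanUVNodesN07P0FixedPointIsRecordMinimiser
import Literature.MathematicalPhysics.QuantumFieldTheory.Balaban1983to89.Node00.BackgroundMapOfRecord

/-!
# N07 ∕ P0 — «[15] THEOREM 1 AS A NAMED MAP», THE KNIT — PART II: AT def-Y's RECORD CARRIER `Node00.BgScheme` (P0 (a), ✓p811606 `Node00/BackgroundMapOfRecord`):
# the five tokens of Part I READ AT `S : BgScheme F N 𝒴 𝒵 K k`, `V ∈ S.dom`, with the distinguished chart point `S.sol V` (= `solA (S.𝒢 V) 0 (S.W V) (S.J V) S.ε₄ (S.𝔄 V)`)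
# and Prop. 6 DISCHARGED by `S.RegimeTok` ⟹ `UniqueUkOrbit … V` ∕ `S.UniqTok ε` (def-Y's TOKEN, here DERIVED from the finer ones), `IsBackground` of the chart point and
# `S.Prop7Tok ε`'s instance, `UkSel … V = rootGauge k (S.chartCfg V)`, and the analyticity of any coordinate read-out of the selector along a parametrisation of `S.dom`

Cell `pub-ymgap` (YM-PLAN Track A, D-0062), width seat `pub-ymgap-dag-n07-w3` (g23).  `--kind proof --supports stmt-QuantumFields-27930 --as helper` (port row ⁸), COUNT-NEUTRAL.
NEW leaf; theorems only — 0 `def`, 0 `sorry`, 0 `instance`, 0 `notation`; standard axioms.  Imports this seat's PART I ✓p811578 `…N07P0FixedPointIsRecordMinimiser` (§1–§4: the knit,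
the scheme instance, the analyticity transfer, the NODE 00 objects with the chart abstract) and def-Y g35's P0 (a) ✓p811606 `Node00/BackgroundMapOfRecord` (`BgScheme`, `sol`,
`expo`, `chartCfg`, `IsChartImage`, tokens `RegimeTok ∕ ChartSUTok ∕ Prop7Tok ∕ UniqTok`, `UkSel_eq_rootGauge_of_isBackground_chart`, `analyticOnNhd_sol_comp`); nothing there edited.
[15] = [Balaban1985Variational]; [I] = [Balaban1987RG1].

WHAT.  def-Y's edition carries [15] Thm 1 at the record as DATA (`BgScheme`) + four displayed TOKENS, of which `Prop7Tok` («some gauge transform of the chart image of the fixed point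
IS a (0.21)-minimiser») and `UniqTok` («`UniqueUkOrbit` on the domain») are the CONTENT.  Part I showed, with the chart abstract, that BOTH follow from the finer printed structure —
(rng) chart range ⊆ class ∩ fibre, (cov) coverage up to residual gauge, (c→s) chart minimiser ⇒ ball solution of (116), (min) the fixed point minimises on the chart — plus Prop. 6's
uniqueness, which the `Regime` DISCHARGES.  This file is the substitution `𝒢, Λ, W, J, 𝔄, ε₄ := S.𝒢 V, 0, S.W V, S.J V, S.𝔄 V, S.ε₄`, `A⋆ := S.sol V`, regime := `S.RegimeTok`, with the
chart still a free function `Φ : 𝒴 → GaugeField (F.P K) 0 (SU N)` on `Kc : Set 𝒴` (def-Y's `chartCfg S V` is the chart AT the fixed point only; a chart as a function of the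
small field is M1∕M2 of def-Y's census — no lattice instance), linked to def-Y's image by ONE displayed equation `hΦ : Φ (S.sol V) = gaugeAct u (S.chartCfg V)` or orbit relation.
* §1 ★★★ `uniqueUkOrbit_of_tokens_at` — tokens at `V ∈ S.dom` ⟹ `UniqueUkOrbit F N K k ε V`; `uniqTok_of_tokens` — tokens at every `V ∈ S.dom` ⟹ `S.UniqTok ε` (def-Y's token
  DERIVED); `isBackground_chartPoint_of_tokens_at` ⟹ `IsBackground … V (Φ (S.sol V))`, hence `prop7Tok_of_tokens` (with the link `hΦ`) ⟹ `S.Prop7Tok ε`; ★★★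
  `ukSel_eq_rootGauge_chartCfg_of_tokens_at` — tokens + «`Φ (S.sol V)` is residual-gauge equivalent to `S.chartCfg V`» ⟹ `UkSel F N K k ε V = rootGauge k (S.chartCfg V)`
  (№509 (A)'s named map `U_k = rootGauge ∘ chart ∘ fix(mapT)` at def-Y's names, `k ≤ m + K`).
* §2 ★★ `analyticOnNhd_selector_coords_of_eqOn` — along a parametrisation `γ : 𝒰 → (coarse fields)` of `S.dom` by an open set of a complete complex space: `S.RegimeTok` + def-Y §5's
  data-analyticity premises + a coordinate map `Ψ` jointly analytic on `𝒪 ×ˢ {‖Y‖ < ε₄′}` (`S.ε₄ < ε₄′`) ⟹ ANY read-out `sel : 𝒰 → X` agreeing on `𝒪` with `u ↦ Ψ u (S.sol (γ u))`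
  is analytic on `𝒪` — the `hBg`∕TokP9-reg shape once `Ψ u (S.sol (γ u))` is the coordinate expression of `rootGauge k (S.chartCfg (γ u))` (the consumer's instantiation).

HONEST FRAMING (binding).  Substitution + by-name application of Part I and of def-Y's §4–§5; NOTHING of [15] asserted: (rng)(cov)(c→s)(min), the link `hΦ`, `S.RegimeTok`,
`S.ChartSUTok` and the data analyticity remain DISPLAYED HYPOTHESES ((min)'s global half unprinted, D-B11-2); no lattice instance of `BgScheme` exists (def-Y M1); `UkExists ∕
UniqueUkOrbit ∕ hBg` are NOT discharged at the record unconditionally; N07 NOT discharged; P0 OPEN; 27930 ∕ 27931 ∕ 26648 ∕ K0ᴬ ∕ K1ᴬ ∕ K3ᴬ OPEN; COUNT 8∕28 · K 1∕4 UNMOVED;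
R4 = the CONDITIONAL finite-𝕋⁴ rung `BalabanLadder.UV` only — NOT continuum ∕ ℝ⁴ ∕ OS; the Yang–Mills mass gap (Clay) is NOT proved by any of this.
-/

noncomputable section

open Set Metric Filter Topology

namespace Summit.QuantumFields.YangMills.Theorems.N07P0FixedPointIsRecordMinimiser

open Literature.MathematicalPhysics.QuantumFieldTheory.Balaban1983to89
open Literature.MathematicalPhysics.QuantumFieldTheory.Balaban1983to89.Node00
open Literature.MathematicalPhysics.QuantumFieldTheory.Balaban1983to89.T4Continuum (T4Family)
open Literature.MathematicalPhysics.QuantumFieldTheory.Balaban1983to89.B12GaugeOrbits021 (OrbitRel)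
open Literature.MathematicalPhysics.QuantumFieldTheory.Balaban1983to89.T4RootedResidualGauge (rootGauge rootGauge_eq_of_orbitRel)
open Literature.MathematicalPhysics.QuantumFieldTheory.Balaban1983to89.B11Prop6Scheme (mapT)
open Literature.MathematicalPhysics.QuantumFieldTheory.Balaban1983to89.B11Eq174Chart (Regime solA)
open GaugeField (gaugeAct)

/-! ## §1  The tokens at def-Y's carrier: `UniqueUkOrbit`, `UniqTok`, `IsBackground`, `Prop7Tok`, `UkSel = rootGauge ∘ chartCfg` -/

section AtScheme

variable {F : T4Family} {N : ℕ} [NeZero N] {𝒴 𝒵 : Type} [NormedAddCommGroup 𝒴] [NormedSpace ℂ 𝒴] [CompleteSpace 𝒴] [NormedAddCommGroup 𝒵] [NormedSpace ℂ 𝒵]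
variable {K k : ℕ} {S : BgScheme F N 𝒴 𝒵 K k} {ε : ℝ} {V : GaugeField (F.P K) k (SU N)}
variable {Kc : Set 𝒴} {Φ : 𝒴 → GaugeField (F.P K) 0 (SU N)}

/-- **★★★ THE TOKENS AT `V ∈ S.dom` ⟹ `UniqueUkOrbit F N K k ε V`** — Part I's `uniqueUkOrbit_chart_of_scheme` at def-Y's data `(S.𝒢 V, 0, S.W V, S.J V, S.𝔄 V, S.ε₄)`, regime from
`S.RegimeTok`, distinguished point `S.sol V`; displayed: (rng)(cov)(c→s)(min) for an abstract chart `Φ` on `Kc`.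
[cite: Balaban1985Variational, Thm 1 p.279, Prop. 6 (117)–(121) p.295, Prop. 2 p.281, (142) p.299; Balaban1987RG1, (1.1) p.260] -/
theorem uniqueUkOrbit_of_tokens_at (hR : S.RegimeTok) (hV : V ∈ S.dom)
    (range : ∀ A ∈ Kc, Φ A ∈ bgReg F N K k ε ∧ Averaging.iter (avOfRecord F N K) k (Φ A) = V)
    (covers : ∀ U : GaugeField (F.P K) 0 (SU N), U ∈ bgReg F N K k ε → Averaging.iter (avOfRecord F N K) k U = V → ∃ A ∈ Kc, OrbitRel k (Φ A) U)
    (sol_of_isMinOn : ∀ A ∈ Kc, IsMinOn (wilsonAction4 ∘ Φ) Kc A → ‖A‖ ≤ S.ε₄ ∧ mapT (S.𝒢 V) 0 (S.W V) (S.J V) (S.𝔄 V) A = A)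
    (star_mem : S.sol V ∈ Kc) (star_isMinOn : IsMinOn (wilsonAction4 ∘ Φ) Kc (S.sol V)) :
    UniqueUkOrbit F N K k ε V :=
  uniqueUkOrbit_chart_of_scheme (hR V hV).1 (hR V hV).2.1 (hR V hV).2.2 range covers sol_of_isMinOn star_mem star_isMinOn

/-- **def-Y's TOKEN `UniqTok` DERIVED**: the finer tokens at every `V` of the domain (chart `Φ V`, chart set `Kc V` may depend on `V`) ⟹ `S.UniqTok ε`.
[cite: Balaban1985Variational, Thm 1 p.279, Prop. 6 p.295] -/
theorem uniqTok_of_tokens (hR : S.RegimeTok) {KcV : GaugeField (F.P K) k (SU N) → Set 𝒴}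
    {ΦV : GaugeField (F.P K) k (SU N) → 𝒴 → GaugeField (F.P K) 0 (SU N)}
    (range : ∀ V ∈ S.dom, ∀ A ∈ KcV V, ΦV V A ∈ bgReg F N K k ε ∧ Averaging.iter (avOfRecord F N K) k (ΦV V A) = V)
    (covers : ∀ V ∈ S.dom, ∀ U : GaugeField (F.P K) 0 (SU N), U ∈ bgReg F N K k ε → Averaging.iter (avOfRecord F N K) k U = V →
      ∃ A ∈ KcV V, OrbitRel k (ΦV V A) U)
    (sol_of_isMinOn : ∀ V ∈ S.dom, ∀ A ∈ KcV V, IsMinOn (wilsonAction4 ∘ ΦV V) (KcV V) A → ‖A‖ ≤ S.ε₄ ∧ mapT (S.𝒢 V) 0 (S.W V) (S.J V) (S.𝔄 V) A = A)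
    (star_mem : ∀ V ∈ S.dom, S.sol V ∈ KcV V) (star_isMinOn : ∀ V ∈ S.dom, IsMinOn (wilsonAction4 ∘ ΦV V) (KcV V) (S.sol V)) :
    S.UniqTok ε := fun V hV =>
  uniqueUkOrbit_of_tokens_at hR hV (range V hV) (covers V hV) (sol_of_isMinOn V hV) (star_mem V hV) (star_isMinOn V hV)

omit [CompleteSpace 𝒴] in
/-- **THE TOKENS ⟹ `IsBackground … V (Φ (S.sol V))`** — the chart image of def-Y's fixed point, under the abstract chart, IS a (0.21)-minimiser over `V` (Part I §4).
[cite: Balaban1985Variational, Thm 1 (8) p.279, Prop. 7 p.299, (142) p.299; Balaban1987RG1, (0.21) p.256] -/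
theorem isBackground_chartPoint_of_tokens_at
    (range : ∀ A ∈ Kc, Φ A ∈ bgReg F N K k ε ∧ Averaging.iter (avOfRecord F N K) k (Φ A) = V)
    (covers : ∀ U : GaugeField (F.P K) 0 (SU N), U ∈ bgReg F N K k ε → Averaging.iter (avOfRecord F N K) k U = V → ∃ A ∈ Kc, OrbitRel k (Φ A) U)
    (star_mem : S.sol V ∈ Kc) (star_isMinOn : IsMinOn (wilsonAction4 ∘ Φ) Kc (S.sol V)) :
    IsBackground (avOfRecord F N K) (bgReg F N K k ε) k V (Φ (S.sol V)) :=
  isBackground_chart_of_tokens range covers star_mem star_isMinOn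

omit [CompleteSpace 𝒴] in
/-- **def-Y's TOKEN `Prop7Tok` DERIVED at `V`** from the tokens and the LINK `Φ (S.sol V) = (S.chartCfg V)^u` (the abstract chart read at the fixed point IS a gauge transform of
def-Y's chart image — displayed; with `u = 1` when `Φ` extends `chartCfg` literally). [cite: Balaban1985Variational, Prop. 7 p.299 («U_k = (U₁U₀)^u»)] -/
theorem prop7Tok_at_of_tokens
    (range : ∀ A ∈ Kc, Φ A ∈ bgReg F N K k ε ∧ Averaging.iter (avOfRecord F N K) k (Φ A) = V)
    (covers : ∀ U : GaugeField (F.P K) 0 (SU N), U ∈ bgReg F N K k ε → Averaging.iter (avOfRecord F N K) k U = V → ∃ A ∈ Kc, OrbitRel k (Φ A) U)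
    (star_mem : S.sol V ∈ Kc) (star_isMinOn : IsMinOn (wilsonAction4 ∘ Φ) Kc (S.sol V))
    {u : GaugeTransf (F.P K) 0 (SU N)} (hΦ : Φ (S.sol V) = gaugeAct u (S.chartCfg V)) :
    ∃ u : GaugeTransf (F.P K) 0 (SU N), IsBackground (avOfRecord F N K) (bgReg F N K k ε) k V (gaugeAct u (S.chartCfg V)) :=
  ⟨u, hΦ ▸ isBackground_chartPoint_of_tokens_at range covers star_mem star_isMinOn⟩

omit [CompleteSpace 𝒴] in
/-- **def-Y's TOKEN `Prop7Tok` DERIVED on the domain** (charts and links may depend on `V`). [cite: Balaban1985Variational, Prop. 7 p.299, Prop. 8 p.304] -/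
theorem prop7Tok_of_tokens {KcV : GaugeField (F.P K) k (SU N) → Set 𝒴} {ΦV : GaugeField (F.P K) k (SU N) → 𝒴 → GaugeField (F.P K) 0 (SU N)}
    {uV : GaugeField (F.P K) k (SU N) → GaugeTransf (F.P K) 0 (SU N)}
    (range : ∀ V ∈ S.dom, ∀ A ∈ KcV V, ΦV V A ∈ bgReg F N K k ε ∧ Averaging.iter (avOfRecord F N K) k (ΦV V A) = V)
    (covers : ∀ V ∈ S.dom, ∀ U : GaugeField (F.P K) 0 (SU N), U ∈ bgReg F N K k ε → Averaging.iter (avOfRecord F N K) k U = V →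
      ∃ A ∈ KcV V, OrbitRel k (ΦV V A) U)
    (star_mem : ∀ V ∈ S.dom, S.sol V ∈ KcV V) (star_isMinOn : ∀ V ∈ S.dom, IsMinOn (wilsonAction4 ∘ ΦV V) (KcV V) (S.sol V))
    (hΦ : ∀ V ∈ S.dom, ΦV V (S.sol V) = gaugeAct (uV V) (S.chartCfg V)) :
    S.Prop7Tok ε := fun V hV =>
  prop7Tok_at_of_tokens (range V hV) (covers V hV) (star_mem V hV) (star_isMinOn V hV) (hΦ V hV)

/-- **★★★ №509 (A)'s NAMED MAP AT def-Y's NAMES**: the tokens at `V ∈ S.dom` and «`Φ (S.sol V)` is RESIDUAL-gauge equivalent to `S.chartCfg V`» ⟹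
`UkSel F N K k ε V = rootGauge k (S.chartCfg V)` (`k ≤ m + K`).  Prop. 6 discharged by `S.RegimeTok`; displayed: (rng)(cov)(c→s)(min) + the orbit link.
[cite: Balaban1985Variational, Thm 1 p.279, Prop. 6 p.295, (174) p.305; Balaban1987RG1, (1.1) p.260, (2.3) p.265] -/
theorem ukSel_eq_rootGauge_chartCfg_of_tokens_at (hk : k ≤ (F.P K).m + (F.P K).K) (hR : S.RegimeTok) (hV : V ∈ S.dom)
    (range : ∀ A ∈ Kc, Φ A ∈ bgReg F N K k ε ∧ Averaging.iter (avOfRecord F N K) k (Φ A) = V)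
    (covers : ∀ U : GaugeField (F.P K) 0 (SU N), U ∈ bgReg F N K k ε → Averaging.iter (avOfRecord F N K) k U = V → ∃ A ∈ Kc, OrbitRel k (Φ A) U)
    (sol_of_isMinOn : ∀ A ∈ Kc, IsMinOn (wilsonAction4 ∘ Φ) Kc A → ‖A‖ ≤ S.ε₄ ∧ mapT (S.𝒢 V) 0 (S.W V) (S.J V) (S.𝔄 V) A = A)
    (star_mem : S.sol V ∈ Kc) (star_isMinOn : IsMinOn (wilsonAction4 ∘ Φ) Kc (S.sol V))
    (hlink : OrbitRel k (S.chartCfg V) (Φ (S.sol V))) :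
    UkSel F N K k ε V = rootGauge k (S.chartCfg V) := by
  rw [ukSel_eq_rootGauge_chart_solA hk (hR V hV).1 (hR V hV).2.1 (hR V hV).2.2 range covers sol_of_isMinOn star_mem star_isMinOn]
  exact rootGauge_eq_of_orbitRel hlink

/-- The same with the literal link `Φ (S.sol V) = S.chartCfg V` (the abstract chart EXTENDS def-Y's chart image).
[cite: Balaban1985Variational, Thm 1 p.279, (174) p.305; Balaban1987RG1, (1.1) p.260] -/
theorem ukSel_eq_rootGauge_chartCfg_of_tokens_at_eq (hk : k ≤ (F.P K).m + (F.P K).K) (hR : S.RegimeTok) (hV : V ∈ S.dom)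
    (range : ∀ A ∈ Kc, Φ A ∈ bgReg F N K k ε ∧ Averaging.iter (avOfRecord F N K) k (Φ A) = V)
    (covers : ∀ U : GaugeField (F.P K) 0 (SU N), U ∈ bgReg F N K k ε → Averaging.iter (avOfRecord F N K) k U = V → ∃ A ∈ Kc, OrbitRel k (Φ A) U)
    (sol_of_isMinOn : ∀ A ∈ Kc, IsMinOn (wilsonAction4 ∘ Φ) Kc A → ‖A‖ ≤ S.ε₄ ∧ mapT (S.𝒢 V) 0 (S.W V) (S.J V) (S.𝔄 V) A = A)
    (star_mem : S.sol V ∈ Kc) (star_isMinOn : IsMinOn (wilsonAction4 ∘ Φ) Kc (S.sol V))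
    (hlink : Φ (S.sol V) = S.chartCfg V) :
    UkSel F N K k ε V = rootGauge k (S.chartCfg V) :=
  ukSel_eq_rootGauge_chartCfg_of_tokens_at hk hR hV range covers sol_of_isMinOn star_mem star_isMinOn (by rw [hlink]; exact OrbitRel.refl _ _)

end AtScheme

/-! ## §2  Analyticity of a coordinate read-out of the selector along a parametrisation of `S.dom` (def-Y §5 + Part I §3) -/

section Analytic

variable {F : T4Family} {N : ℕ} {𝒴 𝒵 : Type} [NormedAddCommGroup 𝒴] [NormedSpace ℂ 𝒴] [CompleteSpace 𝒴] [NormedAddCommGroup 𝒵] [NormedSpace ℂ 𝒵]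
  [CompleteSpace 𝒵]
variable {K k : ℕ} {S : BgScheme F N 𝒴 𝒵 K k}
variable {𝒰 X : Type*} [NormedAddCommGroup 𝒰] [NormedSpace ℂ 𝒰] [CompleteSpace 𝒰] [NormedAddCommGroup X] [NormedSpace ℂ X]
variable {𝒪 : Set 𝒰} {γ : 𝒰 → GaugeField (F.P K) k (SU N)}

/-- **★★ A COORDINATE READ-OUT OF THE SELECTOR IS ANALYTIC ALONG A PARAMETRISATION OF THE DOMAIN.**  `γ` maps the open `𝒪` into `S.dom`; `S.RegimeTok`; def-Y §5's
data-analyticity premises (`S.𝒢 ∘ γ`, `(u, Y) ↦ S.W (γ u) Y` jointly on `𝒪 × {‖Y‖ < a₃}`, `S.J ∘ γ`, `S.𝔄 ∘ γ` analytic); a coordinate map `Ψ` jointly analytic on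
`𝒪 ×ˢ {‖Y‖ < ε₄′}`, `S.ε₄ < ε₄′`.  Then any `sel : 𝒰 → X` with `sel u = Ψ u (S.sol (γ u))` on `𝒪` — e.g. the coordinates of `UkSel … (γ u) = rootGauge k (S.chartCfg (γ u))` (§1)
expressed through `S.sol` — is `AnalyticOnNhd ℂ sel 𝒪`: the `hBg`∕TokP9-reg shape of the port rows, [15] Prop. 9 «analytic function of B, and also of U».
[cite: Balaban1985Variational, Prop. 9 p.309, p.296, (174) p.305] -/
theorem analyticOnNhd_selector_coords_of_eqOn (h𝒪 : IsOpen 𝒪) (hγ : MapsTo γ 𝒪 S.dom) (hR : S.RegimeTok)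
    (h𝒢 : AnalyticOnNhd ℂ (fun u => S.𝒢 (γ u)) 𝒪)
    (hW : AnalyticOnNhd ℂ (fun p : 𝒰 × 𝒴 => S.W (γ p.1) p.2) (𝒪 ×ˢ {Y : 𝒴 | ‖Y‖ < S.a₃}))
    (hJ : AnalyticOnNhd ℂ (fun u => S.J (γ u)) 𝒪) (h𝔄 : AnalyticOnNhd ℂ (fun u => S.𝔄 (γ u)) 𝒪)
    {ε₄' : ℝ} (hε : S.ε₄ < ε₄') {Ψ : 𝒰 → 𝒴 → X}
    (hΨ : AnalyticOnNhd ℂ (fun p : 𝒰 × 𝒴 => Ψ p.1 p.2) (𝒪 ×ˢ {Y : 𝒴 | ‖Y‖ < ε₄'}))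
    {sel : 𝒰 → X} (hsel : ∀ u ∈ 𝒪, sel u = Ψ u (S.sol (γ u))) :
    AnalyticOnNhd ℂ sel 𝒪 :=
  analyticOnNhd_of_eqOn_comp_solA (𝒢 := fun u => S.𝒢 (γ u)) (Λ := fun _ => (0 : 𝒴 →L[ℂ] 𝒴)) (W := fun u => S.W (γ u))
    (J := fun u => S.J (γ u)) (𝔄 := fun u => S.𝔄 (γ u)) h𝒪
    (fun u hu => (hR (γ u) (hγ hu)).1) (fun u hu => (hR (γ u) (hγ hu)).2.1) (fun u hu => (hR (γ u) (hγ hu)).2.2)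
    h𝒢 (fun _ _ => analyticAt_const) hW hJ h𝔄 hε hΨ hsel

end Analytic

end Summit.QuantumFields.YangMills.Theorems.N07P0FixedPointIsRecordMinimiser

end
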